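import Literature.AlgebraicGeometry.HodgeTheory.ChernCharacterLawsAlgebraicity
import HarnessLib

/-!
# `stub_algebraicity` of the crux line `grothendieck_axiomatic` for `ChernCharacterOnBetti` — HOLDS

Route `EightfoldBlochSeeds` (decl of record shared with `EightfoldTwistedSheafSeeds` / `TensorMonadSeeds` /
`FirstOrderSemiregularSeeds` / `VHCAbelianSchemesRoad`), item `stmt-HodgeConjecture-19780` (`ChernCharacterOnBetti`),
helper (`--supports`). HONEST FRAMING: nothing here proves 19780 / 18880 / 18882 / 18883 / H2 / HC_AV / HC_CM / HC;
no definition, no named fact. It settles ONE registered stub of the crux skeleton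
`Summits/HodgeConjecture/HodgeConjecture/Cruxes/ChernCharacterOnBetti/Lines/grothendieck_axiomatic.lean`:

  `theorem stub_algebraicity : ∀ ch : ChernDatum, IsTopologicalChernCharacter ch →`
  `    ∀ {n : ℕ} {X : SchemeOver ℂ}, IsSmoothProjective n X →`
  `      ∀ (E : X.left.Modules), IsVectorBundle E → ∀ i : ℕ, ch X E i ∈ algebraicClasses X i`

— ALGEBRAICITY of every lawful topological Chern character on smooth projective complex varieties (Fulton
Prop. 19.1.2 / Cor. 19.2 (b); Voisin I Thm. 11.32), by the Literature theorem
`HodgeTheory.ch_mem_algebraicClasses_of_laws` (`HodgeTheory/ChernCharacterLawsAlgebraicity`), which needs only FOUR of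
the nine fields of `IsTopologicalChernCharacter` (`ch_congr`, `ch_shortExact`, `map_ch`, `ch_of_hasRankLE_one`) and NO
normalisation, rationality or non-degeneracy.

WHY THE SIGNATURE IS NOT VERBATIM. The skeleton's `ChernDatum` / `IsTopologicalChernCharacter` are declared INSIDE the
crux workfile (`namespace …Cruxes.ChernCharacterOnBetti.GrothendieckAxiomatic`), which a `Theorems` file may not import
(CONVENTIONS §2: Theorems import Mathlib / Literature / HarnessLib / Statement / Theorems / Theses only). So
`stub_algebraicity_holds` takes the datum with `ChernDatum` unfolded and the four used fields as hypotheses, in the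
field order of the structure; inside the skeleton the stub is then discharged by the one-liner

  `theorem stub_algebraicity : … := fun ch h _ _ hX E hE i =>`
  `  Summit.HodgeConjecture.HodgeConjecture.Theorems.stub_algebraicity_holds ch`
  `    h.ch_congr h.ch_shortExact h.map_ch h.ch_of_hasRankLE_one hX E hE i`

(checked against a verbatim copy of the structure: `lean check` rc 0). The remaining stubs of the line
(`stub_rung_firstChernClass`, `stub_extendBySplitting`, `stub_span`) are untouched.

[cite: Fulton1998, Prop. 19.1.2 and Cor. 19.2 (b)] [cite: VoisinHodgeI2002, Thm. 11.32] [cite: Grothendieck1958, Thm. 1 and §2]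
-/

noncomputable section

-- single-problem summit (Problem = Summit): the mandated namespace repeats `HodgeConjecture`.
set_option linter.dupNamespace false

open CategoryTheory AlgebraicGeometry
open Literature.AlgebraicGeometry.Motives Literature.AlgebraicGeometry.HodgeTheory
open Literature.AlgebraicTopology.SingularHomology

namespace Summit.HodgeConjecture.HodgeConjecture.Theorems

/-- **`stub_algebraicity` HOLDS**: for every Chern-character datum `ch X E i ∈ H²ⁱ(X(ℂ); ℂ)` on all `ℂ`-schemes that
is invariant under isomorphism, additive on short exact sequences of vector bundles, functorial along `ℂ`-morphisms
and exponential on modules of rank `≤ 1` — in particular for every `ch` satisfying the nine topological laws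
`IsTopologicalChernCharacter` of the crux line `grothendieck_axiomatic` — and every vector bundle `E` on a smooth
projective complex variety `X`, `ch X E i ∈ algebraicClasses X i = Nⁱ H²ⁱ(X(ℂ); ℂ)` for all `i`. The registered stub
follows by `fun ch h => stub_algebraicity_holds ch h.ch_congr h.ch_shortExact h.map_ch h.ch_of_hasRankLE_one`.
[cite: Fulton1998, Prop. 19.1.2 and Cor. 19.2 (b)] [cite: VoisinHodgeI2002, Thm. 11.32] [cite: Grothendieck1958, Thm. 1 and §2] -/
theorem stub_algebraicity_holds :
    ∀ ch : (∀ (X : SchemeOver ℂ) (E : X.left.Modules) (i : ℕ), complexBetti X (2 * i)),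
      (∀ {X : SchemeOver ℂ} {E F : X.left.Modules} (_ : E ≅ F) (i : ℕ), ch X E i = ch X F i) →
      (∀ {X : SchemeOver ℂ} (S : ShortComplex X.left.Modules), S.ShortExact →
        IsVectorBundle S.X₁ → IsVectorBundle S.X₃ → ∀ i : ℕ, ch X S.X₂ i = ch X S.X₁ i + ch X S.X₃ i) →
      (∀ {X Y : SchemeOver ℂ} (f : Y ⟶ X) (E : X.left.Modules), IsVectorBundle E →
        ∀ i : ℕ, complexBetti.map f (2 * i) (ch X E i) = ch Y ((Scheme.Modules.pullback f.left).obj E) i) →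
      (∀ {X : SchemeOver ℂ} {L : X.left.Modules}, HasRankLE L 1 →
        ∀ {i : ℕ}, 0 < i → ch X L i = ((Nat.factorial i : ℕ) : ℂ)⁻¹ • cupPowTwo (ch X L 1) i) →
      ∀ {n : ℕ} {X : SchemeOver ℂ}, IsSmoothProjective n X →
        ∀ (E : X.left.Modules), IsVectorBundle E → ∀ i : ℕ, ch X E i ∈ algebraicClasses X i :=
  fun ch h_congr h_shortExact h_map h_exp _ _ hX E hE i =>
    ch_mem_algebraicClasses_of_laws ch h_congr h_shortExact h_map h_exp hX E hE i

/-- **The cycle field for free, structure form**: any would-be `ChernCharacterBetti` whose data satisfy the four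
topological laws gets its field `ch_mem_algebraicClasses` from them — recorded as the statement that for an actual
`C : ChernCharacterBetti` the field is RECOVERED from `ch_congr`, `ch_shortExact`, `map_ch`, `ch_of_hasRankLE_one`
alone (a consistency check of the hypothesis structure: the cycle law is not independent of the topological laws).
[cite: Fulton1998, Prop. 19.1.2] [cite: Grothendieck1958, Thm. 1] -/
theorem ch_mem_algebraicClasses_of_topologicalLaws (C : ChernCharacterBetti) {n : ℕ} {X : SchemeOver ℂ}
    (hX : IsSmoothProjective n X) (E : X.left.Modules) (hE : IsVectorBundle E) (i : ℕ) :
    C.ch X E i ∈ algebraicClasses X i :=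
  stub_algebraicity_holds C.ch (fun e i => C.ch_congr e i) (fun S hS h₁ h₃ i => C.ch_shortExact S hS h₁ h₃ i)
    (fun f E hE i => C.map_ch f E hE i) (fun hL _ hi => C.ch_of_hasRankLE_one hL hi) hX E hE i

end Summit.HodgeConjecture.HodgeConjecture.Theorems

end
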